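import Mathlib
import HarnessLib
import Summits.Ventures.LatticeQCDFlow.Exactness.SUNJitteredHMCCertificates
import Summits.Ventures.LatticeQCDFlow.Exactness.SUNMetropolisORSweepFiguresOfMerit
import Summits.Ventures.LatticeQCDFlow.Exactness.CabibboMarinariORSweepFiguresOfMerit
import Summits.Ventures.LatticeQCDFlow.Exactness.SUNLeapfrogHMCORSweepFiguresOfMerit
import Summits.Ventures.LatticeQCDFlow.Exactness.NCMCGeneralSpaceGammaMethodWindow

/-!
# Exponential decorrelation of the engine's chains as run: `τ_exp`-type bounds from the certificates (GEN-23, row 9 eng-latcore, 23-22)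

NEW WORK of the cell, not a published result; no definition is introduced; nothing is cited as a fact.
HONEST FRAMING: exact (Metropolis-corrected) sampling algorithms for lattice gauge theory; figures of merit are
autocorrelation/cost numbers at stated couplings and volumes; no continuum-physics claim.

Besides `τ_int`, the cell's autocorrelation vocabulary has the EXPONENTIAL autocorrelation time: the rate at which the
stationary autocovariance `C_f̄(t)` of an observable and the relaxation `K^t g` of a centred observable decay.  Row
31's `GeneralNCMC.abs_autocov_centred_le_of_nHit` and `GeneralNCMC.decay_of_nHit` prove, for ANY Markov kernel with an
invariant probability `π` and a Doeblin power `ε ν(B) ≤ K^m(x, B)` (`ε ≤ 1`):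
(A) `|C_f̄(t)| ≤ 2 (2C)² (1 − ε)^{⌊t/m⌋}` for every `|f| ≤ C` measurable — so `τ_exp ≤ m/(−log(1 − ε))` for EVERY
    bounded observable at once;
(R) `|K^t g (x)| ≤ 2 C_g (1 − ε)^{⌊t/m⌋}` for every centred bounded measurable `g` and EVERY state `x` — the
    expectation of any bounded observable after `t` updates from ANY start is within `2 C_g (1 − ε)^{⌊t/m⌋}` of its
    Wilson value (thermalisation of observables, uniformly in the start).

THIS FILE applies (A) and (R) to the Doeblin CERTIFICATES of GEN-23 — the engine's update paths AS RUN on `SU(N)`, any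
`β`, `L ≥ 2` where a sweep is involved — with the certificate's `m, ε′` (existential: what is certified is the
geometric SHAPE with ONE rate for all observables, not a number):

* §1 jittered `'hmc'` with one short atom: **`wilsonJitterHMC_abs_autocov_le`** (A), **`wilsonJitterHMC_relaxation_le`** (R);
* §2 jittered `'hmc'` + ANY exact step: **`wilsonJitterHMC_exactStep_abs_autocov_le`**, **`wilsonJitterHMC_exactStep_relaxation_le`**;
* §3 DEFAULT fixed-step `'hmc'` + ANY exact step: **`wilson_sunLeapfrogHMCN_exactStep_abs_autocov_le`**,
  **`wilson_sunLeapfrogHMCN_exactStep_relaxation_le`**;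
* §4 `'metro' + n_or × 'or'`: **`wilson_sunMetropolis_orSweep_abs_autocov_le`**, **`wilson_sunMetropolis_orSweep_relaxation_le`**;
* §5 CM `'hb' + n_or × 'or'` (`m = 1`): **`wilson_cmSweep_orSweep_abs_autocov_le`**, **`wilson_cmSweep_orSweep_relaxation_le`**.

NOT CLAIMED: any value of `m`, `ε′`; optimality of the rate; reversibility / spectral statements; the capped loops.
-/

noncomputable section

namespace Summit.Ventures.LatticeQCDFlow.Exactness

open MeasureTheory ProbabilityTheory ProbabilityTheory.Kernel Set Function Filter Topology
open Literature.MathematicalPhysics.QuantumFieldTheory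
open Literature.MathematicalPhysics.QuantumLattice (fundamentalRep continuous_fundamentalRep connectedSpace_specialUnitaryGroup)
open Summit.Ventures.LatticeQCDFlow.Scoring (autocov kop)
open scoped ENNReal Matrix Matrix.Norms.Operator NNReal

/-! ## §1 The jittered `'hmc'` path with one short atom -/

section Jittered

variable {N d L : ℕ} [NeZero N] [NeZero L] (β : ℝ)
variable {Lab : Type*} [Countable Lab] [MeasurableSpace Lab] [MeasurableSingletonClass Lab]

/-- **(A) ONE GEOMETRIC RATE FOR THE AUTOCOVARIANCE OF EVERY BOUNDED OBSERVABLE — JITTERED ENGINE HMC.**  There is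
`τ₀ > 0` (depending on `N, d, L, β` only) such that whenever one atom `l₀` of the jitter law has `1 ≤ nstep l₀`,
`η {l₀} ≠ 0`, `0 < τ l₀ ≤ τ₀`, there are `m > 0` and `0 < ε′ ≤ 1` with `|C_f̄(t)| ≤ 2 (2C)² (1 − ε′)^{⌊t/m⌋}` for
every `|f| ≤ C` measurable and every lag `t`. -/
theorem wilsonJitterHMC_abs_autocov_le :
    ∃ τ₀ : ℝ, 0 < τ₀ ∧ ∀ (nstep : Lab → ℕ) (τ : Lab → ℝ) (η : Measure Lab) [IsProbabilityMeasure η] (l₀ : Lab),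
      1 ≤ nstep l₀ → η {l₀} ≠ 0 → 0 < τ l₀ → τ l₀ ≤ τ₀ →
      ∃ m : ℕ, ∃ ε' : ℝ≥0∞, 0 < m ∧ 0 < ε' ∧ ε' ≤ 1 ∧
      ∀ (f : GaugeConfig d L (Matrix.specialUnitaryGroup (Fin N) ℂ) → ℝ), Measurable f → ∀ C : ℝ, (∀ U, |f U| ≤ C) →
        ∀ t : ℕ, |autocov (wilsonJitterHMC N d L β nstep τ η) (wilsonMeasure (d := d) (L := L) (fundamentalRep (Fin N)) (β / N))
            (fun y => f y - ∫ z, f z ∂(wilsonMeasure (d := d) (L := L) (fundamentalRep (Fin N)) (β / N))) t| ≤ 2 * (2 * C) ^ 2 * (1 - ε'.toReal) ^ (t / m) := by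
  obtain ⟨τ₀, hτ₀, h⟩ := wilsonJitterHMC_certificate (N := N) (d := d) (L := L) (Lab := Lab) β
  refine ⟨τ₀, hτ₀, fun nstep τ η _ l₀ hn hl₀ hτl hτl₀ => ?_⟩
  obtain ⟨m, ε', hm, hε0, hε1, hmin⟩ := h nstep τ η l₀ hn hl₀ hτl hτl₀
  exact ⟨m, ε', hm, hε0, hε1, fun f hf C hC t => GeneralNCMC.abs_autocov_centred_le_of_nHit
    (GeneralNCMC.minorised_setwise hmin) hε1 (wilsonJitterHMC_invariant (N := N) (d := d) (L := L) β nstep τ η) hf hC t⟩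

/-- **(R) THERMALISATION OF OBSERVABLES FROM ANY START — JITTERED ENGINE HMC**: same `τ₀`, `m`, `ε′`; for every centred
bounded measurable `g` (`∫ g dπ = 0`, `|g| ≤ C_g`), every `t` and EVERY configuration `U`,
`|(K^t g)(U)| ≤ 2 C_g (1 − ε′)^{⌊t/m⌋}`. -/
theorem wilsonJitterHMC_relaxation_le :
    ∃ τ₀ : ℝ, 0 < τ₀ ∧ ∀ (nstep : Lab → ℕ) (τ : Lab → ℝ) (η : Measure Lab) [IsProbabilityMeasure η] (l₀ : Lab),
      1 ≤ nstep l₀ → η {l₀} ≠ 0 → 0 < τ l₀ → τ l₀ ≤ τ₀ →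
      ∃ m : ℕ, ∃ ε' : ℝ≥0∞, 0 < m ∧ 0 < ε' ∧ ε' ≤ 1 ∧
        ∀ (g : GaugeConfig d L (Matrix.specialUnitaryGroup (Fin N) ℂ) → ℝ), Measurable g → ∀ Cg : ℝ, (∀ U, |g U| ≤ Cg) →
          ∫ U, g U ∂(wilsonMeasure (d := d) (L := L) (fundamentalRep (Fin N)) (β / N)) = 0 →
          ∀ (t : ℕ) (U : GaugeConfig d L (Matrix.specialUnitaryGroup (Fin N) ℂ)),
            |(kop (wilsonJitterHMC N d L β nstep τ η))^[t] g U|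
              ≤ 2 * Cg * (1 - ε'.toReal) ^ (t / m) := by
  obtain ⟨τ₀, hτ₀, h⟩ := wilsonJitterHMC_certificate (N := N) (d := d) (L := L) (Lab := Lab) β
  refine ⟨τ₀, hτ₀, fun nstep τ η _ l₀ hn hl₀ hτl hτl₀ => ?_⟩
  obtain ⟨m, ε', hm, hε0, hε1, hmin⟩ := h nstep τ η l₀ hn hl₀ hτl hτl₀
  exact ⟨m, ε', hm, hε0, hε1, GeneralNCMC.decay_of_nHit (GeneralNCMC.minorised_setwise hmin) hε1
    (wilsonJitterHMC_invariant (N := N) (d := d) (L := L) β nstep τ η)⟩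

/-! ## §2 The jittered `'hmc'` path followed by ANY exact step -/

/-- **(A) FOR THE COMPOSITE `P ∘ K_jit`** — `P` ANY Markov kernel leaving `wilsonMeasure (β/N)` invariant. -/
theorem wilsonJitterHMC_exactStep_abs_autocov_le :
    ∃ τ₀ : ℝ, 0 < τ₀ ∧ ∀ (nstep : Lab → ℕ) (τ : Lab → ℝ) (η : Measure Lab) [IsProbabilityMeasure η] (l₀ : Lab),
      1 ≤ nstep l₀ → η {l₀} ≠ 0 → 0 < τ l₀ → τ l₀ ≤ τ₀ →
      ∀ (P : Kernel (GaugeConfig d L (Matrix.specialUnitaryGroup (Fin N) ℂ)) (GaugeConfig d L (Matrix.specialUnitaryGroup (Fin N) ℂ)))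
        [IsMarkovKernel P], Invariant P (wilsonMeasure (d := d) (L := L) (fundamentalRep (Fin N)) (β / N)) →
      ∃ m : ℕ, ∃ ε' : ℝ≥0∞, 0 < m ∧ 0 < ε' ∧ ε' ≤ 1 ∧
      ∀ (f : GaugeConfig d L (Matrix.specialUnitaryGroup (Fin N) ℂ) → ℝ), Measurable f → ∀ C : ℝ, (∀ U, |f U| ≤ C) →
        ∀ t : ℕ, |autocov (P ∘ₖ wilsonJitterHMC N d L β nstep τ η) (wilsonMeasure (d := d) (L := L) (fundamentalRep (Fin N)) (β / N))
            (fun y => f y - ∫ z, f z ∂(wilsonMeasure (d := d) (L := L) (fundamentalRep (Fin N)) (β / N))) t| ≤ 2 * (2 * C) ^ 2 * (1 - ε'.toReal) ^ (t / m) := by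
  obtain ⟨τ₀, hτ₀, h⟩ := wilsonJitterHMC_exactStep_certificate (N := N) (d := d) (L := L) (Lab := Lab) β
  refine ⟨τ₀, hτ₀, fun nstep τ η _ l₀ hn hl₀ hτl hτl₀ P _ hP => ?_⟩
  obtain ⟨hinv, m, ε', hm, hε0, hε1, hmin⟩ := h nstep τ η l₀ hn hl₀ hτl hτl₀ P hP
  haveI := isMarkovKernel_wilsonJitterHMC (N := N) (d := d) (L := L) β nstep τ η
  exact ⟨m, ε', hm, hε0, hε1, fun f hf C hC t =>
    GeneralNCMC.abs_autocov_centred_le_of_nHit (GeneralNCMC.minorised_setwise hmin) hε1 hinv hf hC t⟩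

/-- **(R) FOR THE COMPOSITE `P ∘ K_jit`**: thermalisation of every centred bounded observable from any start. -/
theorem wilsonJitterHMC_exactStep_relaxation_le :
    ∃ τ₀ : ℝ, 0 < τ₀ ∧ ∀ (nstep : Lab → ℕ) (τ : Lab → ℝ) (η : Measure Lab) [IsProbabilityMeasure η] (l₀ : Lab),
      1 ≤ nstep l₀ → η {l₀} ≠ 0 → 0 < τ l₀ → τ l₀ ≤ τ₀ →
      ∀ (P : Kernel (GaugeConfig d L (Matrix.specialUnitaryGroup (Fin N) ℂ)) (GaugeConfig d L (Matrix.specialUnitaryGroup (Fin N) ℂ)))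
        [IsMarkovKernel P], Invariant P (wilsonMeasure (d := d) (L := L) (fundamentalRep (Fin N)) (β / N)) →
      ∃ m : ℕ, ∃ ε' : ℝ≥0∞, 0 < m ∧ 0 < ε' ∧ ε' ≤ 1 ∧
        ∀ (g : GaugeConfig d L (Matrix.specialUnitaryGroup (Fin N) ℂ) → ℝ), Measurable g → ∀ Cg : ℝ, (∀ U, |g U| ≤ Cg) →
          ∫ U, g U ∂(wilsonMeasure (d := d) (L := L) (fundamentalRep (Fin N)) (β / N)) = 0 →
          ∀ (t : ℕ) (U : GaugeConfig d L (Matrix.specialUnitaryGroup (Fin N) ℂ)),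
            |(kop (P ∘ₖ wilsonJitterHMC N d L β nstep τ η))^[t] g U|
              ≤ 2 * Cg * (1 - ε'.toReal) ^ (t / m) := by
  obtain ⟨τ₀, hτ₀, h⟩ := wilsonJitterHMC_exactStep_certificate (N := N) (d := d) (L := L) (Lab := Lab) β
  refine ⟨τ₀, hτ₀, fun nstep τ η _ l₀ hn hl₀ hτl hτl₀ P _ hP => ?_⟩
  obtain ⟨hinv, m, ε', hm, hε0, hε1, hmin⟩ := h nstep τ η l₀ hn hl₀ hτl hτl₀ P hP
  haveI := isMarkovKernel_wilsonJitterHMC (N := N) (d := d) (L := L) β nstep τ η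
  exact ⟨m, ε', hm, hε0, hε1, GeneralNCMC.decay_of_nHit (GeneralNCMC.minorised_setwise hmin) hε1 hinv⟩

end Jittered

/-! ## §3 The DEFAULT fixed-step `'hmc'` followed by ANY exact step -/

section FixedStep

variable (N : ℕ) [NeZero N] {d L : ℕ} [NeZero L] (β : ℝ)

/-- **(A) FOR `P ∘ K_hmc` (FIXED STEP, `nstep · ε ≤ τ₀`)** — `P` ANY exact step. -/
theorem wilson_sunLeapfrogHMCN_exactStep_abs_autocov_le :
    ∃ τ₀ : ℝ, 0 < τ₀ ∧ ∀ (nstep : ℕ) (ε : ℝ), 1 ≤ nstep → 0 < ε → nstep * ε ≤ τ₀ →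
      ∀ (P : Kernel (GaugeConfig d L (Matrix.specialUnitaryGroup (Fin N) ℂ)) (GaugeConfig d L (Matrix.specialUnitaryGroup (Fin N) ℂ)))
        [IsMarkovKernel P], Invariant P (wilsonMeasure (d := d) (L := L) (fundamentalRep (Fin N)) (β / N)) →
      ∀ [IsMarkovKernel (sunLeapfrogHMCN (sunCoordι N) (sunCoordι_skew N) ε (Measure.addHaar : Measure (SUNCoords N))
                  (sunKinetic N) (measurable_halfKick_sun N (measurable_sunWilsonForceLaw_coeConfig N (d := d) (L := L) β) ε)
                  (fun U => β / N * wilsonAction (fundamentalRep (Fin N)) U) nstep)],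
      ∃ m : ℕ, ∃ ε' : ℝ≥0∞, 0 < m ∧ 0 < ε' ∧ ε' ≤ 1 ∧
      ∀ (f : GaugeConfig d L (Matrix.specialUnitaryGroup (Fin N) ℂ) → ℝ), Measurable f → ∀ C : ℝ, (∀ U, |f U| ≤ C) →
        ∀ t : ℕ, |autocov (P ∘ₖ (sunLeapfrogHMCN (sunCoordι N) (sunCoordι_skew N) ε (Measure.addHaar : Measure (SUNCoords N))
                  (sunKinetic N) (measurable_halfKick_sun N (measurable_sunWilsonForceLaw_coeConfig N (d := d) (L := L) β) ε)
                  (fun U => β / N * wilsonAction (fundamentalRep (Fin N)) U) nstep)) (wilsonMeasure (d := d) (L := L) (fundamentalRep (Fin N)) (β / N))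
            (fun y => f y - ∫ z, f z ∂(wilsonMeasure (d := d) (L := L) (fundamentalRep (Fin N)) (β / N))) t| ≤ 2 * (2 * C) ^ 2 * (1 - ε'.toReal) ^ (t / m) := by
  obtain ⟨τ₀, hτ₀, h⟩ := wilson_sunLeapfrogHMCN_exactStep_certificate N (d := d) (L := L) β
  refine ⟨τ₀, hτ₀, fun nstep ε hn hε hτ P _ hP _ => ?_⟩
  obtain ⟨hinv, m, ε', hm, hε0, hε1, hmin⟩ := h nstep ε hn hε hτ P hP
  exact ⟨m, ε', hm, hε0, hε1, fun f hf C hC t =>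
    GeneralNCMC.abs_autocov_centred_le_of_nHit (GeneralNCMC.minorised_setwise hmin) hε1 hinv hf hC t⟩

/-- **(R) FOR `P ∘ K_hmc`**: thermalisation of every centred bounded observable from any start. -/
theorem wilson_sunLeapfrogHMCN_exactStep_relaxation_le :
    ∃ τ₀ : ℝ, 0 < τ₀ ∧ ∀ (nstep : ℕ) (ε : ℝ), 1 ≤ nstep → 0 < ε → nstep * ε ≤ τ₀ →
      ∀ (P : Kernel (GaugeConfig d L (Matrix.specialUnitaryGroup (Fin N) ℂ)) (GaugeConfig d L (Matrix.specialUnitaryGroup (Fin N) ℂ)))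
        [IsMarkovKernel P], Invariant P (wilsonMeasure (d := d) (L := L) (fundamentalRep (Fin N)) (β / N)) →
      ∀ [IsMarkovKernel (sunLeapfrogHMCN (sunCoordι N) (sunCoordι_skew N) ε (Measure.addHaar : Measure (SUNCoords N))
                  (sunKinetic N) (measurable_halfKick_sun N (measurable_sunWilsonForceLaw_coeConfig N (d := d) (L := L) β) ε)
                  (fun U => β / N * wilsonAction (fundamentalRep (Fin N)) U) nstep)],
      ∃ m : ℕ, ∃ ε' : ℝ≥0∞, 0 < m ∧ 0 < ε' ∧ ε' ≤ 1 ∧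
        ∀ (g : GaugeConfig d L (Matrix.specialUnitaryGroup (Fin N) ℂ) → ℝ), Measurable g → ∀ Cg : ℝ, (∀ U, |g U| ≤ Cg) →
          ∫ U, g U ∂(wilsonMeasure (d := d) (L := L) (fundamentalRep (Fin N)) (β / N)) = 0 →
          ∀ (t : ℕ) (U : GaugeConfig d L (Matrix.specialUnitaryGroup (Fin N) ℂ)),
            |(kop (P ∘ₖ (sunLeapfrogHMCN (sunCoordι N) (sunCoordι_skew N) ε (Measure.addHaar : Measure (SUNCoords N))
                  (sunKinetic N) (measurable_halfKick_sun N (measurable_sunWilsonForceLaw_coeConfig N (d := d) (L := L) β) ε)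
                  (fun U => β / N * wilsonAction (fundamentalRep (Fin N)) U) nstep)))^[t] g U| ≤ 2 * Cg * (1 - ε'.toReal) ^ (t / m) := by
  obtain ⟨τ₀, hτ₀, h⟩ := wilson_sunLeapfrogHMCN_exactStep_certificate N (d := d) (L := L) β
  refine ⟨τ₀, hτ₀, fun nstep ε hn hε hτ P _ hP _ => ?_⟩
  obtain ⟨hinv, m, ε', hm, hε0, hε1, hmin⟩ := h nstep ε hn hε hτ P hP
  exact ⟨m, ε', hm, hε0, hε1, GeneralNCMC.decay_of_nHit (GeneralNCMC.minorised_setwise hmin) hε1 hinv⟩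

end FixedStep

/-! ## §4 `'metro' + n_or × 'or'` -/

section MetroOR

variable (N : ℕ) (s : ℝ) [Fact (0 < s)] [NeZero N]
variable {d L : ℕ} {m : Type*} [Fintype m] [DecidableEq m]

/-- **(A) FOR `'metro' + n_or × 'or'`** (`L ≥ 2`, `nhit ≥ 1`, the link list visits every link, any OR schedule). -/
theorem wilson_sunMetropolis_orSweep_abs_autocov_le [NeZero L] (hL : 2 ≤ L) (β : ℝ) {nhit : ℕ} (hn : 1 ≤ nhit)
    {Ls : List (Edge d L)} (hLs : ∀ e, e ∈ Ls) (sched : List (Edge d L × (Fin N ≃ Fin 2 ⊕ m)))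
    [IsMarkovKernel (metropolisSweep (sunMetropolisKick N s)
                (fun U : GaugeConfig d L (Matrix.specialUnitaryGroup (Fin N) ℂ) => Real.exp (-β * wilsonAction (suRep N) U)) nhit Ls)] :
    ∃ mm : ℕ, ∃ ε' : ℝ≥0∞, 0 < mm ∧ 0 < ε' ∧ ε' ≤ 1 ∧
      ∀ (f : GaugeConfig d L (Matrix.specialUnitaryGroup (Fin N) ℂ) → ℝ), Measurable f → ∀ C : ℝ, (∀ U, |f U| ≤ C) →
      ∀ t : ℕ, |autocov (cmORSweep sched ∘ₖ metropolisSweep (sunMetropolisKick N s)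
                (fun U : GaugeConfig d L (Matrix.specialUnitaryGroup (Fin N) ℂ) => Real.exp (-β * wilsonAction (suRep N) U)) nhit Ls)
            (wilsonMeasure (d := d) (L := L) (suRep N) β)
          (fun y => f y - ∫ z, f z ∂(wilsonMeasure (d := d) (L := L) (suRep N) β)) t| ≤ 2 * (2 * C) ^ 2 * (1 - ε'.toReal) ^ (t / mm) := by
  haveI := isProbabilityMeasure_wilsonMeasure_suRep N (d := d) (L := L) β
  obtain ⟨hinv, mm, ε', hmm, hε0, hε1, hmin⟩ :=
    wilson_sunMetropolis_orSweep_certificate N s (d := d) hL β hn hLs sched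
  exact ⟨mm, ε', hmm, hε0, hε1, fun f hf C hC t =>
    GeneralNCMC.abs_autocov_centred_le_of_nHit (GeneralNCMC.minorised_setwise hmin) hε1 hinv hf hC t⟩

/-- **(R) FOR `'metro' + n_or × 'or'`**: thermalisation of every centred bounded observable from any start. -/
theorem wilson_sunMetropolis_orSweep_relaxation_le [NeZero L] (hL : 2 ≤ L) (β : ℝ) {nhit : ℕ} (hn : 1 ≤ nhit)
    {Ls : List (Edge d L)} (hLs : ∀ e, e ∈ Ls) (sched : List (Edge d L × (Fin N ≃ Fin 2 ⊕ m)))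
    [IsMarkovKernel (metropolisSweep (sunMetropolisKick N s)
                (fun U : GaugeConfig d L (Matrix.specialUnitaryGroup (Fin N) ℂ) => Real.exp (-β * wilsonAction (suRep N) U)) nhit Ls)] :
    ∃ mm : ℕ, ∃ ε' : ℝ≥0∞, 0 < mm ∧ 0 < ε' ∧ ε' ≤ 1 ∧
      ∀ (g : GaugeConfig d L (Matrix.specialUnitaryGroup (Fin N) ℂ) → ℝ), Measurable g → ∀ Cg : ℝ, (∀ U, |g U| ≤ Cg) →
          ∫ U, g U ∂(wilsonMeasure (d := d) (L := L) (suRep N) β) = 0 →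
        ∀ (t : ℕ) (U : GaugeConfig d L (Matrix.specialUnitaryGroup (Fin N) ℂ)), |(kop (cmORSweep sched ∘ₖ metropolisSweep (sunMetropolisKick N s)
                (fun U : GaugeConfig d L (Matrix.specialUnitaryGroup (Fin N) ℂ) => Real.exp (-β * wilsonAction (suRep N) U)) nhit Ls))^[t] g U|
              ≤ 2 * Cg * (1 - ε'.toReal) ^ (t / mm) := by
  haveI := isProbabilityMeasure_wilsonMeasure_suRep N (d := d) (L := L) β
  obtain ⟨hinv, mm, ε', hmm, hε0, hε1, hmin⟩ :=
    wilson_sunMetropolis_orSweep_certificate N s (d := d) hL β hn hLs sched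
  exact ⟨mm, ε', hmm, hε0, hε1, GeneralNCMC.decay_of_nHit (GeneralNCMC.minorised_setwise hmin) hε1 hinv⟩

end MetroOR

/-! ## §5 CM `'hb' + n_or × 'or'` (one-step certificate) -/

section CMOR

variable (N : ℕ) [NeZero N] {d L : ℕ} {m : Type*} [Fintype m] [DecidableEq m]

/-- **(A) FOR `'hb' + n_or × 'or'`** (`L ≥ 2`, lexicographic subgroup order or its reverse, every link visited, any OR
schedule): ONE-STEP certificate, so `|C_f̄(t)| ≤ 2 (2C)² (1 − ε′)^t`. -/
theorem wilson_cmSweep_orSweep_abs_autocov_le [NeZero L] (hL : 2 ≤ L) (β : ℝ) (frames : List (Fin N ≃ Fin 2 ⊕ m))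
    (hlex : frames.map pairOf = lexPairs (Finset.univ.sort (· ≤ ·) : List (Fin N)) ∨
      frames.map pairOf = (lexPairs (Finset.univ.sort (· ≤ ·) : List (Fin N))).reverse)
    {links : List (Edge d L)} (hl : ∀ e, e ∈ links) (sched : List (Edge d L × (Fin N ≃ Fin 2 ⊕ m)))
    [IsMarkovKernel (latSweep (gibbsDensity fun U : GaugeConfig d L (Matrix.specialUnitaryGroup (Fin N) ℂ) => β * wilsonAction (suRep N) U) frames links)] :
    ∃ ε' : ℝ≥0∞, 0 < ε' ∧ ε' ≤ 1 ∧
      ∀ (f : GaugeConfig d L (Matrix.specialUnitaryGroup (Fin N) ℂ) → ℝ), Measurable f → ∀ C : ℝ, (∀ U, |f U| ≤ C) →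
      ∀ t : ℕ, |autocov (cmORSweep sched ∘ₖ
                latSweep (gibbsDensity fun U : GaugeConfig d L (Matrix.specialUnitaryGroup (Fin N) ℂ) => β * wilsonAction (suRep N) U) frames links)
            (wilsonMeasure (d := d) (L := L) (suRep N) β)
          (fun y => f y - ∫ z, f z ∂(wilsonMeasure (d := d) (L := L) (suRep N) β)) t| ≤ 2 * (2 * C) ^ 2 * (1 - ε'.toReal) ^ t := by
  haveI : IsProbabilityMeasure (wilsonMeasure (d := d) (L := L) (suRep N) β) := isProbabilityMeasure_wilsonMeasure _ continuous_suRep β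
  obtain ⟨hinv, ε', hε0, hε1, hmin⟩ := wilson_cmSweep_orSweep_certificate N (d := d) hL β frames hlex hl sched
  refine ⟨ε', hε0, hε1, fun f hf C hC t => ?_⟩
  simpa only [Nat.div_one] using
    GeneralNCMC.abs_autocov_centred_le_of_nHit (GeneralNCMC.minorised_setwise hmin) hε1 hinv hf hC t

/-- **(R) FOR `'hb' + n_or × 'or'`**: `|(K^t g)(U)| ≤ 2 C_g (1 − ε′)^t` for every centred bounded measurable `g`,
every `t`, EVERY configuration `U`. -/
theorem wilson_cmSweep_orSweep_relaxation_le [NeZero L] (hL : 2 ≤ L) (β : ℝ) (frames : List (Fin N ≃ Fin 2 ⊕ m))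
    (hlex : frames.map pairOf = lexPairs (Finset.univ.sort (· ≤ ·) : List (Fin N)) ∨
      frames.map pairOf = (lexPairs (Finset.univ.sort (· ≤ ·) : List (Fin N))).reverse)
    {links : List (Edge d L)} (hl : ∀ e, e ∈ links) (sched : List (Edge d L × (Fin N ≃ Fin 2 ⊕ m)))
    [IsMarkovKernel (latSweep (gibbsDensity fun U : GaugeConfig d L (Matrix.specialUnitaryGroup (Fin N) ℂ) => β * wilsonAction (suRep N) U) frames links)] :
    ∃ ε' : ℝ≥0∞, 0 < ε' ∧ ε' ≤ 1 ∧
      ∀ (g : GaugeConfig d L (Matrix.specialUnitaryGroup (Fin N) ℂ) → ℝ), Measurable g → ∀ Cg : ℝ, (∀ U, |g U| ≤ Cg) →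
          ∫ U, g U ∂(wilsonMeasure (d := d) (L := L) (suRep N) β) = 0 →
      ∀ (t : ℕ) (U : GaugeConfig d L (Matrix.specialUnitaryGroup (Fin N) ℂ)), |(kop (cmORSweep sched ∘ₖ
                latSweep (gibbsDensity fun U : GaugeConfig d L (Matrix.specialUnitaryGroup (Fin N) ℂ) => β * wilsonAction (suRep N) U) frames links))^[t] g U|
              ≤ 2 * Cg * (1 - ε'.toReal) ^ t := by
  haveI : IsProbabilityMeasure (wilsonMeasure (d := d) (L := L) (suRep N) β) := isProbabilityMeasure_wilsonMeasure _ continuous_suRep β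
  obtain ⟨hinv, ε', hε0, hε1, hmin⟩ := wilson_cmSweep_orSweep_certificate N (d := d) hL β frames hlex hl sched
  refine ⟨ε', hε0, hε1, fun g hg Cg hCg hg0 t U => ?_⟩
  simpa only [Nat.div_one] using
    GeneralNCMC.decay_of_nHit (GeneralNCMC.minorised_setwise hmin) hε1 hinv g hg Cg hCg hg0 t U

end CMOR

end Summit.Ventures.LatticeQCDFlow.Exactness

end
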